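import Summits.ResolutionOfSingularities.ResolutionOfSingularities.Theorems.PurelyInseparableDim4ResConeShadeOneStep
import Summits.ResolutionOfSingularities.ResolutionOfSingularities.Theorems.PurelyInseparableDim4ResConeLayerBirths
import Summits.ResolutionOfSingularities.ResolutionOfSingularities.Theorems.PurelyInseparableDim4IsolatedMultiplicityPairs
import HarnessLib
import HarnessLib.Audit.Tags

/-!
# Purely inseparable four-folds — K2(p), PHASE `d = 2`, PART I: letters of a shade-`2` state, the ledger of one
# shade-`2` step, the residual quadric at a CORNER step (every prime; idea-4 «QUADRATIC ABSORPTION», I-4-4 (Q1)(ii)/(Q3))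

[OURS · counted 0 · cell `res-dim4-pi` · seat res-dim4-p-7 g3 · K2(p) lane (holder res-dim4-p-12 lineage; desk WORD #82 (c):
«p-7 g3 = the d = 2 PHASE of the located residue, horizontal cut, both `e_G`»); hand analysis res-dim4-idea-4 (I-4-4).]
Nothing here proves K2(p), `NoIsolatedTrap p p`, or resolution of singularities in dimension ≥ 4 / characteristic `p`.
Setting (`…ResCone*`): an ISOLATED state `s = (F, r, exc)` off the floor, `x^r ∣ F`, shade `2`: `ord₀ F = W + 2`,
`W = |r| ∈ [p − 1, 2p − 4]`, residual quadric `g = resForm s`.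
* §1 LETTERS: `shadeTwo_letters` (chain: `ord₀ F_k = W_k + 2`, `p ≤ W_k + 1`, `W_k + 4 ≤ 2p`), `shadeTwo_ledger` (`r_i ≤ p − 2`,
  `r_i + r_k ≤ p − 2`, `W < r_i + p`, `3W + 4 ≤ 4p`), `degree_add_one_eq_of_apply_eq_zero` (`r_i = 0 ⇒ W = p − 1`), and
  **`not_isPthPowerExponent_add_of_shadeTwo`**: no `x^{r + μ}` with `|μ| ≤ 4` is a `p`-th power (cleaning never touches the
  quadric / cubic / quartic layers of `G = F/x^r`).
* §2 ONE STEP: `r′ = (r|_{b=0}).update j (W + 2 − p)`; CORNER of the boundary ⇒ `W′ + r_j + p = 2W + 2`; a LOST boundary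
  letter ⇒ `W′ = p − 1`.
* §3 CORNER STEP (`b = 0`; (Q1)(ii)): `g` is `x_j`-free, `x^{r+3e_j} ∉ supp F`, and `coeff_μ (resForm s′) = coeff_{r+μ+μ_j e_j} F`
  for `|μ| = 2` (monomials of `g` persist; births `x_j x_a ← x^{r+2e_j+e_a}`, `x_j² ← x^{r+4e_j}`); `supp g ⊆ supp g′`.
* §4 AXIS LEGALITY ((Q3)): at an isolated `q`-fold point every letter `k` has a monomial `x^e ∈ supp F` with `|e| < e_k + q`;
  chart-exponent algebra `x^{r+m} ↦ x^{r′+m′}`, `m′ = m.update j (|m| − 2)`, backward/forward transport at a corner.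
Sequel: `…ResConeShadeTwoCorner` (no corner trap at `d = 2`, every prime).  bears_on: LADDER-RESOLUTION:D157-DOOR2
(res-dim4-pi · K2(p) · phase d = 2).  Supports stmt-ResolutionOfSingularities-16155 (helper).
-/

set_option linter.dupNamespace false -- mandated namespace of this single-conjunct summit

noncomputable section

namespace Summit.ResolutionOfSingularities.ResolutionOfSingularities.Theorems.PIDim4

namespace ResCone

open MvPolynomial Finset
open Literature.AlgebraicGeometry.Resolution
open Literature.AlgebraicGeometry.Resolution.CentreBlowup
open Literature.AlgebraicGeometry.Resolution.Hauser2010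
open Literature.AlgebraicGeometry.Resolution.HauserPerlega2019

variable {K : Type} [Field K]

/-! ## §1 The letters of a shade-`2` state -/

/-- **Ledger bounds at an isolated state with `x^r ∣ F`** (`W = |r|`, any shade): every `r_i ≤ p − 2`, every pair
`r_i + r_k ≤ p − 2`, `W < r_i + p` for every `i`, hence `3W + 4 ≤ 4p`. [OURS · K2(p) phase d = 2] [folklore] -/
theorem shadeTwo_ledger {p : ℕ} (hp2 : 2 ≤ p) {s : State K} (hiso : IsIsolated p s.F)
    (hr : ∀ e ∈ s.F.support, s.r ≤ e) {W : ℕ} (hW : s.r.degree = W) :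
    (∀ i, s.r i ≤ p - 2) ∧ (∀ i k, i ≠ k → s.r i + s.r k ≤ p - 2) ∧ (∀ i, W < s.r i + p) ∧
      3 * W + 4 ≤ 4 * p := by
  have hri : ∀ i, s.r i ≤ p - 2 := fun i => IsolatedBand.apply_le_of_isIsolated hp2 hiso hr i
  have hpair : ∀ i k, i ≠ k → s.r i + s.r k ≤ p - 2 := fun i k hik =>
    IsolatedBand.apply_add_apply_le_of_isIsolated hp2 hiso hr hik
  have htri : ∀ i, W < s.r i + p := fun i => hW ▸ degree_lt_apply_add_of_isIsolated hiso hr i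
  refine ⟨hri, hpair, htri, ?_⟩
  have hsum : W = s.r 0 + s.r 1 + s.r 2 + s.r 3 := by
    rw [← hW, Finsupp.degree_eq_sum, Fin.sum_univ_four]
  have h0 := htri 0; have h1 := htri 1; have h2 := htri 2; have h3 := htri 3
  omega

/-- **A missing boundary letter pins the weight**: at an isolated shade-`2` state off the floor, `r_i = 0` for some
`i` forces `W = p − 1` (`W < r_i + p = p` and `p ≤ W + 1`). [OURS · K2(p) phase d = 2] [folklore] -/
theorem degree_add_one_eq_of_apply_eq_zero {p : ℕ} {s : State K} (hiso : IsIsolated p s.F)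
    (hr : ∀ e ∈ s.F.support, s.r ≤ e) {W : ℕ} (hW : s.r.degree = W) (hpW : p ≤ W + 1) {i : Fin 4}
    (hi : s.r i = 0) : W + 1 = p := by
  have h := degree_lt_apply_add_of_isIsolated hiso hr i
  rw [hW, hi, zero_add] at h
  omega

/-- **NO CLEANING IN THE LOW LAYERS**: at an isolated shade-`2` state off the floor (`ord₀ F = W + 2`,
`p ≤ W + 1`, `W + 4 ≤ 2p`, `x^r ∣ F`) no exponent `r + μ` with `|μ| ≤ 4` is a `p`-th power exponent — the quadric,
cubic and quartic layers of `G = F / x^r` are never deleted. [OURS · K2(p) phase d = 2] [folklore] -/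
theorem not_isPthPowerExponent_add_of_shadeTwo {p : ℕ} (hp2 : 2 ≤ p) {s : State K} (hiso : IsIsolated p s.F)
    (hr : ∀ e ∈ s.F.support, s.r ≤ e) {W : ℕ} (hW : s.r.degree = W) (hpW : p ≤ W + 1) (hW2 : W + 4 ≤ 2 * p)
    {μ : Fin 4 →₀ ℕ} (hμ : μ.degree ≤ 4) : ¬ IsPthPowerExponent p (s.r + μ) := by
  intro hP
  have hdvd := (isPthPowerExponent_iff p (s.r + μ)).mp hP
  have hri : ∀ i, s.r i ≤ p - 2 := fun i => IsolatedBand.apply_le_of_isIsolated hp2 hiso hr i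
  have hpair : ∀ i k, i ≠ k → s.r i + s.r k ≤ p - 2 := fun i k hik =>
    IsolatedBand.apply_add_apply_le_of_isIsolated hp2 hiso hr hik
  have hμi : ∀ i, μ i ≤ 4 := fun i => le_trans (Finsupp.le_degree i μ) hμ
  -- every coordinate of `r + μ` is `0` or `p`
  have hcoord : ∀ i, s.r i + μ i = 0 ∨ s.r i + μ i = p := by
    intro i
    obtain ⟨t, ht⟩ := hdvd i
    rw [Finsupp.add_apply] at ht
    have hlt : s.r i + μ i < 2 * p := by have := hri i; have := hμi i; omega
    rcases t with _ | _ | t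
    · left; simpa using ht
    · right; simpa using ht
    · exfalso
      have h2 : p * 2 ≤ p * (t + 1 + 1) := Nat.mul_le_mul_left p (by omega)
      omega
  have hsumr : W = s.r 0 + s.r 1 + s.r 2 + s.r 3 := by
    rw [← hW, Finsupp.degree_eq_sum, Fin.sum_univ_four]
  have hsumμ : μ.degree = μ 0 + μ 1 + μ 2 + μ 3 := by
    rw [Finsupp.degree_eq_sum, Fin.sum_univ_four]
  have h01 := hpair 0 1 (by decide)
  have h02 := hpair 0 2 (by decide)
  have h03 := hpair 0 3 (by decide)
  have h12 := hpair 1 2 (by decide)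
  have h13 := hpair 1 3 (by decide)
  have h23 := hpair 2 3 (by decide)
  have hr0 := hri 0
  have hr1 := hri 1
  have hr2 := hri 2
  have hr3 := hri 3
  rcases hcoord 0 with h0 | h0 <;> rcases hcoord 1 with h1 | h1 <;> rcases hcoord 2 with h2 | h2 <;>
    rcases hcoord 3 with h3 | h3 <;> omega

/-- **Shade-2 bookkeeping along a chain**: along an isolated above-floor `Step0 p` chain with `x^{r₀} ∣ F₀` and
shade `≡ 2`: `ord₀ F_k = W_k + 2`, `p ≤ W_k + 1`, `W_k + 4 ≤ 2p`. [OURS · K2(p) phase d = 2] [folklore] -/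
theorem shadeTwo_letters (p : ℕ) [hp : Fact p.Prime] [DecidableEq K] {c : ℕ → State K}
    (hc : ∀ k, IsIsolated p (c k).F ∧ Step0 p (c k) (c (k + 1)) ∧ ordZero (c k).F ≠ p ∧ (c k).shade = 2)
    (hr0 : ∀ e ∈ (c 0).F.support, (c 0).r ≤ e) (k : ℕ) :
    ordZero (c k).F = (((c k).r.degree + 2 : ℕ) : ℕ∞) ∧ p ≤ (c k).r.degree + 1 ∧ (c k).r.degree + 4 ≤ 2 * p := by
  have hc2 : ∀ k, IsIsolated p (c k).F ∧ Step0 p (c k) (c (k + 1)) := fun k => ⟨(hc k).1, (hc k).2.1⟩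
  have hr : ∀ e ∈ (c k).F.support, (c k).r ≤ e := IsolatedBand.isolated_chain_forall_le hc2 hr0 k
  obtain ⟨o, ho, hpo, ho2⟩ := BandShade.exists_ordZero_eq p hc2 k
  have hsh := (hc k).2.2.2
  rw [BandShade.shade_eq_coe ho] at hsh
  have h2 : o - (c k).r.degree = 2 := by exact_mod_cast hsh
  have hle := degree_r_le ho hr
  have hoW : o = (c k).r.degree + 2 := by omega
  have hne : o ≠ p := fun h => (hc k).2.2.1 (by rw [ho, h])
  refine ⟨by rw [ho, hoW], ?_, by omega⟩
  rcases Nat.lt_or_ge o (p + 1) with h | h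
  · exfalso; exact hne (by omega)
  · omega

/-! ## §2 The ledger of one shade-`2` step -/

section Step

variable [DecidableEq K]

/-- **The new boundary of a shade-2 step**: `r′ = (r|_{b = 0}).update j (W + 2 − p)`. [folklore] -/
theorem shadeTwo_step_r {p : ℕ} (j : Fin 4) {b : Fin 4 → K} (hbj : b j = 0) (s : State K) {W : ℕ}
    (ho : ordZero s.F = ((W + 2 : ℕ) : ℕ∞)) (hr : ∀ e ∈ s.F.support, s.r ≤ e) :
    (CentreBlowup.step p Finset.univ j b s).r = (s.r.filter (fun i => b i = 0)).update j (W + 2 - p) := by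
  exact step_r_univ p j hbj s ho hr

/-- **Corner bookkeeping**: if the point `b` translates no boundary letter (`b_i = 0` whenever `r_i ≥ 1`) then
`W′ + r_j + p = 2W + 2` (`W′ = (W + 2 − p) + (W − r_j)`, `p ≤ W + 2`). [OURS · K2(p) phase d = 2] [folklore] -/
theorem shadeTwo_step_degree_of_corner {p : ℕ} (j : Fin 4) (b : Fin 4 → K) (s : State K)
    {W : ℕ} (hW : s.r.degree = W) (ho : ordZero s.F = ((W + 2 : ℕ) : ℕ∞))
    (hpW : p ≤ W + 2) (hb : ∀ i, b i = 0 ∨ s.r i = 0) :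
    (CentreBlowup.step p Finset.univ j b s).r.degree + s.r j + p = 2 * W + 2 := by
  have hdeg := degree_step_r' p j b s ho
  have hσ : ∑ i ∈ Finset.univ.erase j, (if b i = 0 then s.r i else 0) = ∑ i ∈ Finset.univ.erase j, s.r i := by
    refine Finset.sum_congr rfl fun i _ => ?_
    rcases hb i with h | h
    · rw [if_pos h]
    · rw [h]; split_ifs <;> rfl
  rw [hσ, sum_erase_eq_degree_sub, hW] at hdeg
  have hj : s.r j ≤ W := hW ▸ Finsupp.le_degree j s.r
  omega

/-- **A lost boundary letter pins the new weight**: if `b_i ≠ 0` for a boundary letter `i ≠ j` (`r_i ≥ 1`) and the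
new state is again isolated of shade `2` off the floor, then `W′ = p − 1`. [OURS · K2(p) phase d = 2] [folklore] -/
theorem shadeTwo_step_degree_of_loss {p : ℕ} (j : Fin 4) {b : Fin 4 → K} (hbj : b j = 0) (s : State K)
    {W : ℕ} (ho : ordZero s.F = ((W + 2 : ℕ) : ℕ∞)) (hr : ∀ e ∈ s.F.support, s.r ≤ e)
    {i : Fin 4} (hbi : b i ≠ 0) (hiso' : IsIsolated p (CentreBlowup.step p Finset.univ j b s).F)
    (hr' : ∀ e ∈ (CentreBlowup.step p Finset.univ j b s).F.support, (CentreBlowup.step p Finset.univ j b s).r ≤ e)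
    (hpW' : p ≤ (CentreBlowup.step p Finset.univ j b s).r.degree + 1) :
    (CentreBlowup.step p Finset.univ j b s).r.degree + 1 = p := by
  have hij : i ≠ j := fun h => hbi (h ▸ hbj)
  have hri' : (CentreBlowup.step p Finset.univ j b s).r i = 0 := by
    rw [shadeTwo_step_r j hbj s ho hr, Finsupp.update_apply, if_neg hij, Finsupp.filter_apply, if_neg hbi]
  exact degree_add_one_eq_of_apply_eq_zero hiso' hr' rfl hpW' hri'

/-! ## §3 The residual quadric at a corner step -/

/-- The top monomial of the unsheared `x^r` is `x^r`. [folklore] -/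
theorem topMonomial_zero (j : Fin 4) (r : Fin 4 →₀ ℕ) : topMonomial j (0 : Fin 4 → K) r = r := by
  ext i
  rw [topMonomial_apply]
  by_cases hij : i = j
  · subst hij
    rw [if_pos rfl, Finset.sum_eq_single i (fun k _ hk => by rw [if_neg (by simp [hk]), mul_zero])
      (fun h => absurd (Finset.mem_univ _) h), if_pos (Or.inl rfl), mul_one]
  · rw [if_neg hij, if_pos (Pi.zero_apply _)]

omit [DecidableEq K] in
/-- On the honest layer the residual cone reads the coefficients of `F` above `x^r`:
`coeff_μ (resForm s) = coeff_{r + μ} F` for `|μ| = ord₀ F − |r|`. [folklore] -/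
theorem coeff_resForm_eq_coeff_add {s : State K} {o : ℕ} (ho : ordZero s.F = o) {μ : Fin 4 →₀ ℕ}
    (hμ : μ.degree = o - s.r.degree) (hro : s.r.degree ≤ o) : coeff μ (resForm s) = coeff (s.r + μ) s.F := by
  rw [coeff_resForm]
  unfold initialForm
  rw [ho, ENat.toNat_coe, coeff_homogeneousComponent, if_pos]
  rw [map_add, hμ]
  omega

/-- **All layers of the new residual cone at a CORNER step** (`b = 0`, any shade-keeping band step, `x^r ∣ F`,
`q < ord₀ F = o`): for `|μ| = d`, `coeff_μ (resForm s′) = coeff_{r + μ + μ_j e_j} F` unless `x^{r′ + μ}` is a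
`q`-th power (p-12's `coeff_resForm_step` with `shear j 0 = id`, `top = r`). [OURS] [folklore] -/
theorem coeff_resForm_step_zero {q : ℕ} (j : Fin 4) {s : State K} {o : ℕ} (ho : ordZero s.F = o)
    (hr : ∀ e ∈ s.F.support, s.r ≤ e) (hqo : q < o)
    (heq : (CentreBlowup.step q Finset.univ j (0 : Fin 4 → K) s).shade = s.shade) {μ : Fin 4 →₀ ℕ}
    (hμ : μ.degree = o - s.r.degree) :
    coeff μ (resForm (CentreBlowup.step q Finset.univ j (0 : Fin 4 → K) s)) =
      if IsPthPowerExponent q ((CentreBlowup.step q Finset.univ j (0 : Fin 4 → K) s).r + μ) then 0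
      else coeff (s.r + μ + Finsupp.single j (μ j)) s.F := by
  rw [coeff_resForm_step j (show (0 : Fin 4 → K) j = 0 from rfl) ho hr hqo heq hμ, topMonomial_zero, shear_zero]

/-- **The residual quadric is `x_j`-free at a shade-keeping corner step** (direction `e_j` in the vertex): for
`|μ| = 2` with `μ_j ≠ 0`, `x^{r + μ} ∉ supp F`. [OURS · K2(p) phase d = 2] [folklore] -/
theorem not_mem_support_add_of_apply_ne_zero {p : ℕ} (j : Fin 4) {s : State K} {W : ℕ} (hW : s.r.degree = W)
    (ho : ordZero s.F = ((W + 2 : ℕ) : ℕ∞)) (hr : ∀ e ∈ s.F.support, s.r ≤ e) (hpW : p ≤ W + 1)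
    (hW2 : W + 4 ≤ 2 * p) (heq : (CentreBlowup.step p Finset.univ j (0 : Fin 4 → K) s).shade = s.shade)
    {μ : Fin 4 →₀ ℕ} (hμ : μ.degree = 2) (hμj : μ j ≠ 0) : s.r + μ ∉ s.F.support := by
  have hqo : p < W + 2 := by omega
  have ho2 : W + 2 < 2 * p := by omega
  have hfree := shear_resForm_free_of_shade_eq j (show (0 : Fin 4 → K) j = 0 from rfl) ho hr hqo ho2 heq
  rw [shear_zero] at hfree
  have hμ0 : coeff μ (resForm s) = 0 := by
    by_contra hne
    exact hμj (hfree μ (MvPolynomial.mem_support_iff.mpr hne))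
  rw [coeff_resForm_eq_coeff_add ho (by rw [hW, hμ]; omega) (by rw [hW]; omega)] at hμ0
  exact MvPolynomial.notMem_support_iff.mpr hμ0

/-- **No pure cube on the chart letter** (`G₃(e_j) = 0`): at a shade-keeping corner step between isolated shade-2
states off the floor, `x^{r + 3e_j} ∉ supp F`. [OURS · K2(p) phase d = 2] [folklore] -/
theorem not_mem_support_add_three_single {p : ℕ} (hp2 : 2 ≤ p) (j : Fin 4) {s : State K} {W : ℕ}
    (hW : s.r.degree = W) (ho : ordZero s.F = ((W + 2 : ℕ) : ℕ∞)) (hr : ∀ e ∈ s.F.support, s.r ≤ e)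
    (hpW : p ≤ W + 1) (hW2 : W + 4 ≤ 2 * p)
    (heq : (CentreBlowup.step p Finset.univ j (0 : Fin 4 → K) s).shade = s.shade)
    (hiso' : IsIsolated p (CentreBlowup.step p Finset.univ j (0 : Fin 4 → K) s).F)
    (hr' : ∀ e ∈ (CentreBlowup.step p Finset.univ j (0 : Fin 4 → K) s).F.support,
      (CentreBlowup.step p Finset.univ j (0 : Fin 4 → K) s).r ≤ e) :
    s.r + Finsupp.single j 3 ∉ s.F.support := by
  intro hmem
  have hqo : p < W + 2 := by omega
  -- the chart image `x^{r′ + e_j}` is not a `p`-th power: its `x_j`-exponent is `r′_j + 1 ≤ p − 1`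
  have hnp : ¬ IsPthPowerExponent p (chartExponent p Finset.univ j (s.r + Finsupp.single j 3)) := by
    intro hP
    have hdvd := (isPthPowerExponent_iff p _).mp hP j
    rw [chartExponent_univ_apply_self, map_add, Finsupp.degree_single, hW] at hdvd
    have hr'j : (CentreBlowup.step p Finset.univ j (0 : Fin 4 → K) s).r j = W + 2 - p := by
      rw [shadeTwo_step_r j rfl s ho hr, Finsupp.update_apply, if_pos rfl]
    have hle : (CentreBlowup.step p Finset.univ j (0 : Fin 4 → K) s).r j ≤ p - 2 :=
      IsolatedBand.apply_le_of_isIsolated hp2 hiso' hr' j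
    rw [hr'j] at hle
    have h1 := Nat.le_of_dvd (by omega) hdvd
    omega
  have habs := apply_add_le_of_mem_support_shear_of_shade_eq j (show (0 : Fin 4 → K) j = 0 from rfl) ho hr hqo
    heq (by rw [shear_zero]; exact hmem) hnp
  rw [topMonomial_zero, Finsupp.add_apply, Finsupp.single_eq_same, map_add, Finsupp.degree_single, hW] at habs
  omega

/-- **THE QUADRIC AT A CORNER STEP** (idea-4 (Q1)(ii)): at a shade-keeping corner step between isolated shade-2
states off the floor, for every `|μ| = 2`: `coeff_μ (resForm s′) = coeff_{r + μ + μ_j e_j} F` — the monomials of `g`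
persist with their coefficients (`μ_j = 0`), the births are `x_j x_a` from `x^{r + 2e_j + e_a}` and `x_j²` from
`x^{r + 4e_j}`. [OURS · K2(p) phase d = 2] [folklore] -/
theorem coeff_resForm_step_zero_of_shadeTwo {p : ℕ} (hp2 : 2 ≤ p) (j : Fin 4) {s : State K} {W : ℕ}
    (hW : s.r.degree = W) (ho : ordZero s.F = ((W + 2 : ℕ) : ℕ∞)) (hr : ∀ e ∈ s.F.support, s.r ≤ e)
    (hpW : p ≤ W + 1) (heq : (CentreBlowup.step p Finset.univ j (0 : Fin 4 → K) s).shade = s.shade)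
    (hiso' : IsIsolated p (CentreBlowup.step p Finset.univ j (0 : Fin 4 → K) s).F)
    (hr' : ∀ e ∈ (CentreBlowup.step p Finset.univ j (0 : Fin 4 → K) s).F.support,
      (CentreBlowup.step p Finset.univ j (0 : Fin 4 → K) s).r ≤ e)
    (hpW' : p ≤ (CentreBlowup.step p Finset.univ j (0 : Fin 4 → K) s).r.degree + 1)
    (hW2' : (CentreBlowup.step p Finset.univ j (0 : Fin 4 → K) s).r.degree + 4 ≤ 2 * p)
    {μ : Fin 4 →₀ ℕ} (hμ : μ.degree = 2) :
    coeff μ (resForm (CentreBlowup.step p Finset.univ j (0 : Fin 4 → K) s)) =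
      coeff (s.r + μ + Finsupp.single j (μ j)) s.F := by
  have hqo : p < W + 2 := by omega
  rw [coeff_resForm_step_zero j ho hr hqo heq (by rw [hW, hμ]; omega), if_neg]
  exact not_isPthPowerExponent_add_of_shadeTwo hp2 hiso' hr' rfl hpW' hW2' (by omega)

/-- **The quadric only absorbs at a corner**: `supp g ⊆ supp g′` (with equal coefficients, by
`coeff_resForm_step_zero_of_shadeTwo` and `not_mem_support_add_of_apply_ne_zero`). [OURS · K2(p) phase d = 2]
[folklore] -/
theorem support_resForm_subset_of_shadeTwo {p : ℕ} (hp2 : 2 ≤ p) (j : Fin 4) {s : State K} {W : ℕ}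
    (hW : s.r.degree = W) (ho : ordZero s.F = ((W + 2 : ℕ) : ℕ∞)) (hr : ∀ e ∈ s.F.support, s.r ≤ e)
    (hpW : p ≤ W + 1) (hW2 : W + 4 ≤ 2 * p)
    (heq : (CentreBlowup.step p Finset.univ j (0 : Fin 4 → K) s).shade = s.shade)
    (hiso' : IsIsolated p (CentreBlowup.step p Finset.univ j (0 : Fin 4 → K) s).F)
    (hr' : ∀ e ∈ (CentreBlowup.step p Finset.univ j (0 : Fin 4 → K) s).F.support,
      (CentreBlowup.step p Finset.univ j (0 : Fin 4 → K) s).r ≤ e)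
    (hpW' : p ≤ (CentreBlowup.step p Finset.univ j (0 : Fin 4 → K) s).r.degree + 1)
    (hW2' : (CentreBlowup.step p Finset.univ j (0 : Fin 4 → K) s).r.degree + 4 ≤ 2 * p) :
    (resForm s).support ⊆ (resForm (CentreBlowup.step p Finset.univ j (0 : Fin 4 → K) s)).support := by
  intro μ hμ
  have hqo : p < W + 2 := by omega
  have ho2 : W + 2 < 2 * p := by omega
  have hne := MvPolynomial.mem_support_iff.mp hμ
  have hdeg : μ.degree = 2 := by
    have h := resForm_isHomogeneous ho hne
    rw [weight_one_eq_degree, hW] at h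
    omega
  have hμj : μ j = 0 := by
    have hfree := shear_resForm_free_of_shade_eq j (show (0 : Fin 4 → K) j = 0 from rfl) ho hr hqo ho2 heq
    rw [shear_zero] at hfree
    exact hfree μ hμ
  rw [MvPolynomial.mem_support_iff, coeff_resForm_step_zero_of_shadeTwo hp2 j hW ho hr hpW heq hiso' hr' hpW' hW2'
    hdeg, hμj, Finsupp.single_zero, add_zero, ← coeff_resForm_eq_coeff_add ho (by rw [hW, hdeg]; omega)
    (by rw [hW]; omega)]
  exact hne

end Step

/-! ## §4 Axis legality and the chart-exponent algebra above `x^r` -/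

/-- **AXIS LEGALITY** (idea-4 (Q3)): at an isolated `q`-fold point, for every letter `k` some monomial `x^e` of `F`
has `|e| < e_k + q` (else the `x_k`-axis `V(x_i : i ≠ k)` is `q`-fold,
`IsolationCert.not_isIsolated_of_le_ordAlong_of_ne_univ`). [OURS] [folklore] -/
theorem exists_degree_lt_apply_add_of_isIsolated {q : ℕ} {F : MvPolynomial (Fin 4) K} (hiso : IsIsolated q F)
    (k : Fin 4) : ∃ e ∈ F.support, e.degree < e k + q := by
  classical
  by_contra hcon
  push Not at hcon
  refine IsolationCert.not_isIsolated_of_le_ordAlong_of_ne_univ (S := Finset.univ.erase k) ?_ ?_ hiso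
  · refine le_ordAlong_iff.mpr fun e he => ?_
    have h := hcon e he
    have hsum := sum_erase_eq_degree_sub e k
    unfold degIn
    exact_mod_cast (show q ≤ ∑ i ∈ Finset.univ.erase k, e i by omega)
  · intro h
    have := Finset.mem_erase.mp ((h.symm ▸ Finset.mem_univ k : k ∈ Finset.univ.erase k))
    exact this.1 rfl

/-- **Chart exponents above `x^r` at the point centre**: `chartExponent q univ j (r + m) = r′ + m′` with
`r′ = r.update j (|r| + d − q)`, `m′ = m.update j (|m| − d)`, for `d ≤ |m|`, `q ≤ |r| + d`. [folklore] -/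
theorem chartExponent_add_eq_update_add_update (q : ℕ) (j : Fin 4) (r m : Fin 4 →₀ ℕ) {d : ℕ} (hd : d ≤ m.degree)
    (hq : q ≤ r.degree + d) :
    chartExponent q Finset.univ j (r + m) = r.update j (r.degree + d - q) + m.update j (m.degree - d) := by
  rw [chartExponent_univ_eq_update, map_add]
  ext i
  rw [Finsupp.update_apply, Finsupp.add_apply, Finsupp.add_apply, Finsupp.update_apply, Finsupp.update_apply]
  by_cases hij : i = j
  · rw [if_pos hij, if_pos hij, if_pos hij]
    omega
  · rw [if_neg hij, if_neg hij, if_neg hij]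

section Transport

variable [DecidableEq K]

/-- **Backward transport above the boundary at a corner step** (shade `2`): every monomial `x^{r′ + m′}` of `F′` is
the chart image of a monomial `x^{r + m}` of `F` with `m′ = m.update j (|m| − 2)` (so `m′_i = m_i` off `j`,
`m′_j + 2 = |m|`, `2 ≤ |m|`). [OURS · K2(p) phase d = 2] [folklore] -/
theorem exists_source_of_corner {p : ℕ} (j : Fin 4) (s : State K) {W : ℕ} (hW : s.r.degree = W)
    (ho : ordZero s.F = ((W + 2 : ℕ) : ℕ∞)) (hr : ∀ e ∈ s.F.support, s.r ≤ e) (hpW : p ≤ W + 2)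
    {m' : Fin 4 →₀ ℕ}
    (hm' : (CentreBlowup.step p Finset.univ j (0 : Fin 4 → K) s).r + m' ∈
      (CentreBlowup.step p Finset.univ j (0 : Fin 4 → K) s).F.support) :
    ∃ m : Fin 4 →₀ ℕ, s.r + m ∈ s.F.support ∧ 2 ≤ m.degree ∧ m' = m.update j (m.degree - 2) := by
  obtain ⟨e, he, heE⟩ := exists_of_mem_support_step_zero j s hm'
  have hle : s.r ≤ e := hr e he
  obtain ⟨m, rfl⟩ : ∃ m, e = s.r + m := ⟨e - s.r, (add_tsub_cancel_of_le hle).symm⟩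
  have hdeg : W + 2 ≤ (s.r + m).degree := by
    by_contra hlt
    exact (MvPolynomial.mem_support_iff.mp he) (((ordZero_eq_nat_iff _ _).mp ho).2 _ (by omega))
  rw [map_add, hW] at hdeg
  have hm2 : 2 ≤ m.degree := by omega
  refine ⟨m, he, hm2, ?_⟩
  have hr' : (CentreBlowup.step p Finset.univ j (0 : Fin 4 → K) s).r = s.r.update j (W + 2 - p) := by
    rw [shadeTwo_step_r j rfl s ho hr]
    congr 1
    ext i
    rw [Finsupp.filter_apply, if_pos (Pi.zero_apply _)]
  rw [chartExponent_add_eq_update_add_update p j s.r m hm2 (by rw [hW]; exact hpW), hW, hr'] at heE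
  exact (add_left_cancel heE).symm

/-- **Forward transport above the boundary at a corner step** (shade `2`, target not cleaned): a monomial
`x^{r + m}` of `F` (`2 ≤ |m|`) whose image `x^{r′ + m′}`, `m′ = m.update j (|m| − 2)`, is not a `p`-th power is a
monomial of `F′`, with the same coefficient. [OURS · K2(p) phase d = 2] [folklore] -/
theorem coeff_corner_of_not_isPthPowerExponent {p : ℕ} (j : Fin 4) (s : State K) {W : ℕ} (hW : s.r.degree = W)
    (ho : ordZero s.F = ((W + 2 : ℕ) : ℕ∞)) (hr : ∀ e ∈ s.F.support, s.r ≤ e) (hpW : p ≤ W + 2)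
    {m : Fin 4 →₀ ℕ} (hm : 2 ≤ m.degree)
    (hnp : ¬ IsPthPowerExponent p
      ((CentreBlowup.step p Finset.univ j (0 : Fin 4 → K) s).r + m.update j (m.degree - 2))) :
    coeff ((CentreBlowup.step p Finset.univ j (0 : Fin 4 → K) s).r + m.update j (m.degree - 2))
        (CentreBlowup.step p Finset.univ j (0 : Fin 4 → K) s).F = coeff (s.r + m) s.F := by
  have hq : (p : ℕ∞) ≤ ordAlong Finset.univ s.F := by
    rw [ordAlong_univ, ho]; exact_mod_cast hpW
  have hr' : (CentreBlowup.step p Finset.univ j (0 : Fin 4 → K) s).r = s.r.update j (W + 2 - p) := by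
    rw [shadeTwo_step_r j rfl s ho hr]
    congr 1
    ext i
    rw [Finsupp.filter_apply, if_pos (Pi.zero_apply _)]
  have hE := chartExponent_add_eq_update_add_update p j s.r m hm (by rw [hW]; exact hpW)
  rw [hW, ← hr'] at hE
  rw [← hE, coeff_step_F_chartExponent p j (show (0 : Fin 4 → K) j = 0 from rfl) s hq
    (by rw [map_add, hW]; omega), if_neg (hE ▸ hnp), shear_zero]

end Transport

end ResCone

end Summit.ResolutionOfSingularities.ResolutionOfSingularities.Theorems.PIDim4

end
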